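import Mathlib.Probability.Distributions.Uniform
import Mathlib.Data.Fintype.BigOperators
import Literature.Computability.Complexity.RandomCNF
import Literature.Computability.MetaComplexity.ScopeExpansion
import HarnessLib

/-!
# Scopes of random `k`-clauses: the clause space `kClauses k n` counted, and `F_k(n, m)` as a count

Trunk Literature/Computability/MetaComplexity. Support file for the discharge of the named fact
`kmow_random_kCNF_plausible` (`ScopeExpansion.lean`; Kothari–Mori–O'Donnell–Witmer 2017,
Thm. 4.12): the deterministic counting facts about the clause space of the tree's random `k`-CNF
model `randomKCNF k n m` (`RandomCNF.lean`) that a first-moment argument over it needs.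

* `map_fst_clauseOf` / `map_snd_clauseOf` (the two projections of `clauseOf S ε`),
  `clauseOf_injOn` — the parametrisation of `kClauses k n` by (variable set of size `k`, sign
  pattern on `Fin k`) used in its definition is injective;
* `card_kClauses : |kClauses k n| = C(n, k) · 2^k`;
* `clauseScope_clauseOf`, `clauseScope_subset_range`, `card_clauseScope_of_mem_kClauses` — the scope
  of a `k`-clause is a `k`-subset of `{0, …, n-1}`;
* `card_filter_clauseScope_subset_le` — at most `C(|V|, k) · 2^k` clauses have scope inside `V`
  (so a uniform clause has scope inside `V` with probability `≤ C(|V|,k)/C(n,k)`);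
* `card_filter_forall_mem` — product counting in `Fin m → X`: prescribing the coordinates in `F`
  to lie in `A` leaves `|A|^{|F|} · |X|^{m-|F|}` points (independence of the `m` clauses);
* `IsCoverExpander.comp`, `cnfScopes_ofFn` — reindexing the scope family of `List.ofFn`;
* `randomKCNF_toOuterMeasure_ge` — the probability glue: if the complement of an event is covered
  by a finset `B` of clause-tuples with `|B| ≤ β |kClauses k n|^m`, the event has
  `randomKCNF`-mass `≥ 1 - β`.

## References

* P. K. Kothari, R. Mori, R. O'Donnell, D. Witmer, *Sum of squares lower bounds for refuting any
  CSP*, STOC 2017, arXiv:1701.04521, Appendix A (the random model: `m` constraints with scopes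
  uniform among `k`-sets of distinct variables, i.i.d.).
* E. Ben-Sasson, A. Wigderson, *Short proofs are narrow — resolution made simple*, J. ACM 48
  (2001), §6 (the distribution `F_k^{n, Δ}`).
-/

noncomputable section

open Finset MeasureTheory Literature.Computability.Complexity

namespace Literature.Computability.MetaComplexity

/-! ### The parametrisation of `kClauses` -/

/-- The variables of `clauseOf S ε`, in order: the sorted elements of `S`. [folklore] -/
theorem map_fst_clauseOf {n : ℕ} (S : Finset (Fin n)) (ε : ℕ → Bool) :
    (clauseOf S ε).map Prod.fst = (S.sort (· ≤ ·)).map (fun v : Fin n => (v : ℕ)) := by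
  simp only [clauseOf, List.map_map, Function.comp_def]
  exact List.zipIdx_map_fst 0 _

/-- The signs of `clauseOf S ε`, in order: `ε 0, …, ε (|S| - 1)`. [folklore] -/
theorem map_snd_clauseOf {n : ℕ} (S : Finset (Fin n)) (ε : ℕ → Bool) :
    (clauseOf S ε).map Prod.snd = (List.range S.card).map ε := by
  have h1 : (clauseOf S ε).map Prod.snd =
      ((((S.sort (· ≤ ·)).map (fun v : Fin n => (v : ℕ))).zipIdx).map Prod.snd).map ε := by
    simp only [clauseOf, List.map_map, Function.comp_def]
  rw [h1, List.zipIdx_map_snd, List.range_eq_range', List.length_map, Finset.length_sort]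

/-- The scope of `clauseOf S ε` is `S` (as a set of naturals). [folklore] -/
theorem clauseScope_clauseOf {n : ℕ} (S : Finset (Fin n)) (ε : ℕ → Bool) :
    clauseScope (clauseOf S ε) = S.map Fin.valEmbedding := by
  rw [clauseScope, map_fst_clauseOf]
  ext v
  simp [Finset.mem_sort]

/-- The parametrisation of `kClauses k n` by (`k`-subsets of `Fin n`) × (sign patterns on
`Fin k`, extended by `false`) used in its definition is injective. [folklore] -/
theorem clauseOf_injOn (k n : ℕ) :
    Set.InjOn (fun p : Finset (Fin n) × (Fin k → Bool) =>
        clauseOf p.1 fun i => if h : i < k then p.2 ⟨i, h⟩ else false)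
      ↑(((univ : Finset (Fin n)).powersetCard k) ×ˢ (univ : Finset (Fin k → Bool))) := by
  rintro ⟨S, e⟩ hS ⟨T, f⟩ hT h
  simp only [coe_product, Set.mem_prod, mem_coe, mem_powersetCard, mem_univ, and_true] at hS hT
  have h1 := congrArg (List.map Prod.fst) h
  have h2 := congrArg (List.map Prod.snd) h
  simp only [map_fst_clauseOf] at h1
  simp only [map_snd_clauseOf] at h2
  have hST : S = T := by
    have h3 := List.map_injective_iff.2 Fin.val_injective h1
    rw [← Finset.sort_toFinset S (· ≤ ·), h3, Finset.sort_toFinset]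
  subst hST
  refine Prod.ext rfl (funext fun i => ?_)
  have h3 := List.map_inj_left.1 h2 i.1 (List.mem_range.2 (hS.2 ▸ i.2))
  simpa using h3

/-- **The size of the clause space**: `|kClauses k n| = C(n, k) · 2^k`. [Ben-Sasson–Wigderson 2001,
§6 ("all `2^k C(n,k)` clauses")] [folklore] -/
theorem card_kClauses (k n : ℕ) : (kClauses k n).card = n.choose k * 2 ^ k := by
  classical
  rw [kClauses, card_image_of_injOn (clauseOf_injOn k n), card_product,
    card_powersetCard, card_univ, Fintype.card_fin, card_univ, Fintype.card_fun, Fintype.card_bool,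
    Fintype.card_fin]

/-- Every `k`-clause is `clauseOf S ε` for a `k`-set `S` and some sign pattern. [folklore] -/
theorem exists_eq_clauseOf_of_mem_kClauses {k n : ℕ} {x : Clause ℕ} (hx : x ∈ kClauses k n) :
    ∃ S : Finset (Fin n), S.card = k ∧ ∃ ε : ℕ → Bool, x = clauseOf S ε := by
  rw [kClauses, mem_image] at hx
  obtain ⟨⟨S, e⟩, hS, rfl⟩ := hx
  simp only [mem_product, mem_powersetCard, subset_univ, mem_univ, and_true, true_and] at hS
  exact ⟨S, hS, _, rfl⟩

/-- The scope of a `k`-clause over `n` variables lies in `{0, …, n-1}`. [folklore] -/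
theorem clauseScope_subset_range {k n : ℕ} {x : Clause ℕ} (hx : x ∈ kClauses k n) :
    clauseScope x ⊆ Finset.range n := by
  obtain ⟨S, -, e, rfl⟩ := exists_eq_clauseOf_of_mem_kClauses hx
  rw [clauseScope_clauseOf]
  intro v hv
  rw [mem_map] at hv
  obtain ⟨i, -, rfl⟩ := hv
  exact mem_range.2 i.2

/-- The scope of a `k`-clause has exactly `k` variables. [folklore] -/
theorem card_clauseScope_of_mem_kClauses {k n : ℕ} {x : Clause ℕ} (hx : x ∈ kClauses k n) :
    (clauseScope x).card = k := by
  obtain ⟨S, hS, e, rfl⟩ := exists_eq_clauseOf_of_mem_kClauses hx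
  rw [clauseScope_clauseOf, card_map, hS]

/-- **Scope marginal.** At most `C(|V|, k) · 2^k` of the `k`-clauses have their scope inside a
given finite set `V` of variables (with `card_kClauses`: a uniform `k`-clause has scope `⊆ V`
with probability `≤ C(|V|, k) / C(n, k)`). [Kothari–Mori–O'Donnell–Witmer 2017, Appendix A
("fixed set of constraints and variables gets at least `A` edges")] [folklore] -/
theorem card_filter_clauseScope_subset_le (k n : ℕ) (V : Finset ℕ) :
    ((kClauses k n).filter fun x => clauseScope x ⊆ V).card ≤ V.card.choose k * 2 ^ k := by
  classical
  rw [kClauses, Finset.filter_image]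
  refine card_image_le.trans ?_
  have h1 : (((univ : Finset (Fin n)).powersetCard k ×ˢ (univ : Finset (Fin k → Bool))).filter
      fun p : Finset (Fin n) × (Fin k → Bool) =>
        clauseScope (clauseOf p.1 fun i => if h : i < k then p.2 ⟨i, h⟩ else false) ⊆ V) =
      (((univ : Finset (Fin n)).powersetCard k).filter
        fun S : Finset (Fin n) => S.map Fin.valEmbedding ⊆ V) ×ˢ (univ : Finset (Fin k → Bool)) := by
    ext ⟨S, e⟩
    simp only [mem_filter, mem_product, mem_univ, and_true, clauseScope_clauseOf]
  rw [h1, card_product, card_univ, Fintype.card_fun, Fintype.card_bool, Fintype.card_fin]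
  refine Nat.mul_le_mul_right _ ?_
  rw [← card_powersetCard k V]
  refine card_le_card_of_injOn (fun S => S.map Fin.valEmbedding) (fun S hS => ?_) ?_
  · rw [mem_coe, mem_filter, mem_powersetCard] at hS
    rw [mem_coe, mem_powersetCard, card_map]
    exact ⟨hS.2, hS.1.2⟩
  · intro S _ T _ h
    exact Finset.map_injective _ h

/-! ### Product counting (independence of the clauses) -/

/-- **Product counting.** In `Fin m → X`, the tuples whose coordinates in `F` lie in `A` number
`|A|^{|F|} · |X|^{m - |F|}`. [folklore] -/
theorem card_filter_forall_mem {X : Type*} [Fintype X] [DecidableEq X] {m : ℕ}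
    (F : Finset (Fin m)) (A : Finset X) :
    (univ.filter fun c : Fin m → X => ∀ i ∈ F, c i ∈ A).card =
      A.card ^ F.card * Fintype.card X ^ (m - F.card) := by
  classical
  have h1 : (univ.filter fun c : Fin m → X => ∀ i ∈ F, c i ∈ A) =
      Fintype.piFinset fun i => if i ∈ F then A else univ := by
    ext c
    simp only [mem_filter, mem_univ, true_and, Fintype.mem_piFinset]
    constructor
    · intro h i
      split_ifs with hi
      · exact h i hi
      · exact mem_univ _
    · intro h i hi
      simpa [hi] using h i
  have h2 : ∀ i : Fin m, (if i ∈ F then A else (univ : Finset X)).card =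
      if i ∈ F then A.card else Fintype.card X := fun i => by
    split_ifs <;> simp
  rw [h1, Fintype.card_piFinset, Finset.prod_congr rfl fun i _ => h2 i, Finset.prod_ite, prod_const,
    prod_const, Finset.filter_mem_eq_inter, univ_inter, Finset.filter_not, Finset.filter_mem_eq_inter,
    univ_inter, card_univ_sdiff, Fintype.card_fin]

/-! ### Reindexing scope families -/

/-- Cover expansion is preserved under injective reindexing of the family. [folklore] -/
theorem IsCoverExpander.comp {ι ι' : Type*} {S : ι → Finset ℕ} {r a : ℝ}
    (h : IsCoverExpander S r a) {e : ι' → ι} (he : Function.Injective e) :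
    IsCoverExpander (S ∘ e) r a := by
  intro F hF
  have h1 := h (F.map ⟨e, he⟩) (by simpa using hF)
  have h2 : cover (S ∘ e) F = cover S (F.map ⟨e, he⟩) := by
    ext v
    simp [mem_cover]
  rw [h2]
  simpa using h1

/-- The scope family of `List.ofFn f` is the family `clauseScope ∘ f`, reindexed along the cast
`Fin (List.ofFn f).length → Fin m`. [folklore] -/
theorem cnfScopes_ofFn {m : ℕ} (f : Fin m → Clause ℕ) :
    cnfScopes (List.ofFn f) =
      (fun j => clauseScope (f j)) ∘ Fin.cast (List.length_ofFn (f := f)) := by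
  funext i
  simp only [cnfScopes, Function.comp_apply, Fin.getElem_fin, List.getElem_ofFn]
  rfl

/-- Hence cover expansion of `clauseScope ∘ f` gives cover expansion of the scope family of the
listed formula `List.ofFn f`. [folklore] -/
theorem IsCoverExpander.cnfScopes_ofFn {m : ℕ} {f : Fin m → Clause ℕ} {r a : ℝ}
    (h : IsCoverExpander (fun j => clauseScope (f j)) r a) :
    IsCoverExpander (cnfScopes (List.ofFn f)) r a := by
  rw [MetaComplexity.cnfScopes_ofFn]
  exact h.comp (Fin.cast_injective _)

/-! ### The random formula as a count -/

/-- **Probability glue.** If `kClauses k n ≠ ∅` and a finset `B` of clause-tuples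
`Fin m → kClauses k n` contains every tuple whose listed formula misses the event `E`, and
`|B| ≤ β · |kClauses k n|^m`, then `Pr_{φ ∼ F_k(n,m)}[E] ≥ 1 - β` (uniform measure on tuples = the
i.i.d. model `randomKCNF`; union with the complement and monotonicity of the outer measure).
[folklore] -/
theorem randomKCNF_toOuterMeasure_ge {k n m : ℕ} (h : (kClauses k n).Nonempty) {E : Set (CNF ℕ)}
    {β : ℝ} (hβ : 0 ≤ β) (B : Finset (Fin m → ↥(kClauses k n)))
    (hB : ∀ c : Fin m → ↥(kClauses k n), c ∉ B →
      (List.ofFn fun i => ((c i : ↥(kClauses k n)) : Clause ℕ)) ∈ E)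
    (hcard : (B.card : ℝ) ≤ β * (((kClauses k n).card ^ m : ℕ) : ℝ)) :
    1 - ENNReal.ofReal β ≤ (randomKCNF k n m).toOuterMeasure E := by
  classical
  haveI : Nonempty ↥(kClauses k n) := h.coe_sort
  have hrw : randomKCNF k n m = (PMF.uniformOfFintype (Fin m → ↥(kClauses k n))).map
      fun c => List.ofFn fun i => (c i : Clause ℕ) := by
    unfold randomKCNF
    rw [dif_pos h]
  rw [hrw, PMF.toOuterMeasure_map_apply]
  set μ := (PMF.uniformOfFintype (Fin m → ↥(kClauses k n))).toOuterMeasure with hμ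
  have h1 : μ (↑B)ᶜ ≤ μ ((fun c => List.ofFn fun i => (c i : Clause ℕ)) ⁻¹' E) := by
    refine measure_mono fun c hc => ?_
    exact hB c (by simpa using hc)
  have h2 : μ ↑B ≤ ENNReal.ofReal β := by
    have h3 : μ ↑B = (B.card : ENNReal) / (((kClauses k n).card ^ m : ℕ) : ENNReal) := by
      rw [hμ, PMF.toOuterMeasure_uniformOfFintype_apply, ← Set.toFinset_card, Finset.toFinset_coe,
        Fintype.card_fun, Fintype.card_fin, Fintype.card_coe]
    rw [h3]
    refine ENNReal.div_le_of_le_mul ?_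
    rw [← ENNReal.ofReal_natCast, ← ENNReal.ofReal_natCast, ← ENNReal.ofReal_mul hβ]
    exact ENNReal.ofReal_le_ofReal hcard
  have h3 : μ Set.univ = 1 := by
    rw [hμ, PMF.toOuterMeasure_apply_eq_one_iff]
    exact Set.subset_univ _
  have h4 : (1 : ENNReal) ≤ μ ↑B + μ (↑B)ᶜ := by
    rw [← h3, ← Set.union_compl_self (↑B : Set (Fin m → ↥(kClauses k n)))]
    exact measure_union_le _ _
  have h5 : (1 : ENNReal) ≤ μ (↑B)ᶜ + ENNReal.ofReal β :=
    calc (1 : ENNReal) ≤ μ ↑B + μ (↑B)ᶜ := h4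
      _ ≤ ENNReal.ofReal β + μ (↑B)ᶜ := add_le_add h2 le_rfl
      _ = μ (↑B)ᶜ + ENNReal.ofReal β := add_comm _ _
  exact (tsub_le_iff_right.2 h5).trans h1

end Literature.Computability.MetaComplexity
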